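import Literature.MathematicalPhysics.QuantumLattice.EmeryThreeBandCuO4ClusterDictionary
import Literature.MathematicalPhysics.QuantumLattice.EmeryThreeBandWindowFloorsPlus
import HarnessLib

/-!
# THE `Cu₄O₄` (ring-8) CLUSTER DICTIONARY: the window `[0,3)² ∖ {(1,1)}` (four Cu, four O; largest spin sector `4900`) fits the three-band interaction,
# its uniformly reweighted Hamiltonian relabelled onto `Fin 1 ×ₗ Fin 8` IS `hubbardOpenBoxGP 1 8 τ υ ν` with explicit tables, and kernel sector floors give the floor

Topic `Literature/MathematicalPhysics/QuantumLattice` (family `hubbard`; crew hubbard-fast S2 (iv) «three-band Emery boxes»). Twin of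
`EmeryThreeBandCuO4ClusterDictionary` (the 5-site plus) for the NEXT producer window recommended by hubbard-box-p3 g18 (EMERY-WINDOWS-g18 /
DOMINANT-SPLIT-g18: ring-8 adds `+0.54…+0.69 eV/CuO₂` to every La₂CuO₄ corner floor over the plus; `D₄`-symmetric, so uniform weights are optimal;
`4900`-class = the kernel device's existing budget):

* §1 `emeryRing8Window = [0,3)² ∖ {(1,1)}` ⊇ `emeryRingWindow` (so it FITS: `emeryRing8Window_fit`), its eight sites in LEXICOGRAPHIC order
  `ring8Site = ((0,0),(0,1),(0,2),(1,0),(1,2),(2,0),(2,1),(2,2))` = (Cu, O_y, Cu, O_x, O_x, Cu, O_y, Cu), ranks `0..7`, and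
  **`ring8SiteEquiv : PolySite emeryRing8Window ≃ Fin 1 ×ₗ Fin 8`**;
* §2 `relabel_ring8_reweight_emeryInteraction` (any weight) and `posSemidef_ring8_reweight_sub_of_gpSectorFloors`;
* §3 KERNEL-DECIDED TABLES: the bond class between two ranks (`ring8AtomOf`: Cu–O `{0,3},{2,4} ↦ 0`, `{3,5},{4,7} ↦ 1`, `{0,1},{5,6} ↦ 2`, `{1,2},{6,7} ↦ 3`;
  O–O `{3,6} ↦ 4`, `{1,3} ↦ 5`, `{4,6} ↦ 6`, `{1,4} ↦ 7`), placement counts (Cu–O bonds `2`, O–O bonds `1`, Cu sites `4`, O sites `2`), hence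
  **`ring8Tau θ M`** (Cu–O entries `M·θ_a/2`, O–O entries `M·θ_a`), **`ring8Ups θ M = M·(θ₁₁/4, θ₁₃/2, θ₁₁/4, θ₁₂/2, θ₁₂/2, θ₁₁/4, θ₁₃/2, θ₁₁/4)`**,
  **`ring8Nu θ M`** (same pattern with `θ₈, θ₁₀, θ₉`); `relabel_ring8_uniform_emeryInteraction`;
* §4 **`posSemidef_ring8_uniform_sub_of_gpSectorFloors`** (`∀ k ≤ 16, q ≤ E₀(hubbardOpenBoxGP 1 8 (ring8Tau θ M) (ring8Ups θ M) (ring8Nu θ M), k)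
  ⇒ H^{w_M}_{W₈}[emeryInteraction θ] − q•1 ⪰ 0`) and the TURNKEY FLOOR **`le_emeryEnergyDensity_of_ring8_gpSectorFloors`**:
  the same sector floors give `q/(4M) ≤ emeryEnergyDensity θ ρ` for every `0 ≤ ρ ≤ 3/2` (tilt `θ + μ•levelDir` on the consumer side as for the plus).

Everything is PROVED (0 sorry); definitions with bodies: `emeryRing8Window`, `ring8Site`, `ring8Rank`, `ring8SiteEquiv`, `ring8AtomOf`, `ring8Tau`, `ring8Ups`, `ring8Nu`.
HONEST SCOPE: plumbing; no number.

## Tree / Mathlib search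

REUSED: everything of `EmeryThreeBandCuO4ClusterDictionary` / `EmeryThreeBandGeneralPairForm` (pattern and lemmas: `localHamiltonian_reweight_emeryInteraction_eq_generalPair`,
`relabel_generalPairHamiltonian`, `emeryTau_symm`, `hopIndNat`, `hopInd_eq_cast`, `emeryAtomU/Eps_eq_cast`, `emeryAtomUNat/EpsNat`); `emeryWindow_fit_of_ring_subset`,
`le_emeryEnergyDensity_of_windowCertificate` (`EmeryThreeBandWindowFloors`); `emeryStates_nonempty`; box-p2's `hubbardOpenBoxGP`, `posSemidef_hubbardOpenBoxGP_sub_smul_one_of_sectors`;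
`posSemidef_relabel`, `relabel_symm_relabel`. `rg 'ring8|Ring8'` (QuantumLattice, 2026-08-28): nothing.

## References

* R. Valentí, J. Stolze, P. J. Hirschfeld, Phys. Rev. B 43 (1991) 13743, §II. [cite: ValentiStolzeHirschfeld1991, §II]
* E. Pavarini et al., Phys. Rev. Lett. 87 (2001) 047003, eq. (1). [cite: PavariniEtAl2001, eq. (1)]
* I. Kull, N. Schuch, B. Dive, M. Navascués, Phys. Rev. X 14 (2024) 021008, §5.3. [cite: KullEtAl2024, §5.3]
-/

noncomputable section

open scoped ComplexOrder BigOperators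
open Finset

namespace Literature.MathematicalPhysics.QuantumLattice

open Matrix HubbardWave0 Literature.Probability.LatticeModels ThermodynamicLimit ClusterLowerBound

/-! ### §1. The ring-8 window, its ranks and the site bijection -/

/-- **The `Cu₄O₄` ring-8 window** `[0,3)² ∖ {(1,1)}`: Cu at the four corners, O_x at `(1,0),(1,2)`, O_y at `(0,1),(2,1)`; Fock dimension `4⁸`,
largest spin sector `C(8,4)² = 4900`. [cite: ValentiStolzeHirschfeld1991, §II] -/
def emeryRing8Window : Finset (Site 2) :=
  (halfOpenBox 2 3).filter fun x => ¬ (x 0 = 1 ∧ x 1 = 1)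

/-- The 7-site ring lies inside the ring-8 window. [cite: ValentiStolzeHirschfeld1991, §II] -/
theorem emeryRingWindow_subset_ring8 : emeryRingWindow ⊆ emeryRing8Window := by decide

/-- **The ring-8 window FITS the three-band interaction** (it contains the fitting 7-site ring), for every `θ`. [cite: ValentiStolzeHirschfeld1991, §II] -/
theorem emeryRing8Window_fit (θ : Fin 14 → ℝ) :
    ∀ (c : Cell liebPeriods) (X : Finset (Site 2)), cellPos c ∈ X → (emeryInteraction θ).Φ X ≠ 0 →
      ∃ v : Site 2, InCoset liebPeriods 0 v ∧ shiftSet v X ⊆ emeryRing8Window :=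
  emeryWindow_fit_of_ring_subset θ emeryRingWindow_subset_ring8

/-- **The sites of the ring-8 window by rank** (lexicographic): `(0,0),(0,1),(0,2),(1,0),(1,2),(2,0),(2,1),(2,2)` = (Cu, O_y, Cu, O_x, O_x, Cu, O_y, Cu).
[cite: ValentiStolzeHirschfeld1991, §II] -/
def ring8Site : Fin 8 → Site 2 := ![![0, 0], ![0, 1], ![0, 2], ![1, 0], ![1, 2], ![2, 0], ![2, 1], ![2, 2]]

/-- Every ranked site lies in the window. [cite: ValentiStolzeHirschfeld1991, §II] -/
theorem ring8Site_mem (k : Fin 8) : ring8Site k ∈ emeryRing8Window := by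
  fin_cases k <;> decide

/-- **The rank of a site** (only used on the window). [cite: ValentiStolzeHirschfeld1991, §II] -/
def ring8Rank (x : Site 2) : Fin 8 :=
  if x = ring8Site 1 then 1 else if x = ring8Site 2 then 2 else if x = ring8Site 3 then 3 else if x = ring8Site 4 then 4 else
    if x = ring8Site 5 then 5 else if x = ring8Site 6 then 6 else if x = ring8Site 7 then 7 else 0

/-- The rank of a ranked site. [cite: ValentiStolzeHirschfeld1991, §II] -/
theorem ring8Rank_ring8Site (k : Fin 8) : ring8Rank (ring8Site k) = k := by
  fin_cases k <;> decide

/-- Every site of the window is a ranked site. [cite: ValentiStolzeHirschfeld1991, §II] -/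
theorem ring8Site_ring8Rank {x : Site 2} (hx : x ∈ emeryRing8Window) : ring8Site (ring8Rank x) = x := by
  rw [emeryRing8Window, Finset.mem_filter, mem_halfOpenBox, Fin.forall_fin_two] at hx
  obtain ⟨⟨⟨h0, h0'⟩, ⟨h1, h1'⟩⟩, h⟩ := hx
  have hx2 : x = ![x 0, x 1] := by funext i; fin_cases i <;> rfl
  have key : (x 0 = 0 ∧ x 1 = 0) ∨ (x 0 = 0 ∧ x 1 = 1) ∨ (x 0 = 0 ∧ x 1 = 2) ∨ (x 0 = 1 ∧ x 1 = 0) ∨ (x 0 = 1 ∧ x 1 = 2) ∨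
      (x 0 = 2 ∧ x 1 = 0) ∨ (x 0 = 2 ∧ x 1 = 1) ∨ (x 0 = 2 ∧ x 1 = 2) := by
    push Not at h
    norm_num at h0' h1'
    omega
  rcases key with ⟨a, b⟩ | ⟨a, b⟩ | ⟨a, b⟩ | ⟨a, b⟩ | ⟨a, b⟩ | ⟨a, b⟩ | ⟨a, b⟩ | ⟨a, b⟩ <;>
    · rw [hx2, a, b]; decide

/-- **The site bijection `PolySite W₈ ≃ Fin 1 ×ₗ Fin 8`** by rank. [cite: ValentiStolzeHirschfeld1991, §II] -/
def ring8SiteEquiv : PolySite emeryRing8Window ≃ Fin 1 ×ₗ Fin 8 where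
  toFun p := toLex (0, ring8Rank (ofLex p.1))
  invFun i := PolySite.pt (ring8Site (ofLex i).2) (ring8Site_mem _)
  left_inv p := by
    apply Subtype.ext
    show toLex (ring8Site (ring8Rank (ofLex p.1))) = p.1
    rw [ring8Site_ring8Rank (PolySite.ofLex_mem p), toLex_ofLex]
  right_inv i := by
    show toLex ((0 : Fin 1), ring8Rank (ring8Site (ofLex i).2)) = i
    rw [ring8Rank_ring8Site, show (0 : Fin 1) = (ofLex i).1 from Subsingleton.elim _ _, Prod.mk.eta, toLex_ofLex]

/-- The inverse bijection sends rank `k` to the site `ring8Site k`. [cite: ValentiStolzeHirschfeld1991, §II] -/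
theorem ring8SiteEquiv_symm_apply (i : Fin 1 ×ₗ Fin 8) : ofLex (ring8SiteEquiv.symm i).1 = ring8Site (ofLex i).2 := rfl

/-! ### §2. The relabelled cluster Hamiltonian (any weight) and the glue -/

/-- `relabel e 1 = 1`, generic rewriting form. [folklore] -/
private theorem relabel_one_generic' {ι ι' : Type*} [LinearOrder ι] [Fintype ι] [LinearOrder ι'] [Fintype ι']
    (e : ι ≃ ι') : relabel e (1 : Matrix (Finset ι) (Finset ι) ℂ) = 1 :=
  map_one (relabel e)

/-- **THE RING-8 DICTIONARY (any weight)**. [cite: ValentiStolzeHirschfeld1991, §II] [cite: PavariniEtAl2001, eq. (1)] -/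
theorem relabel_ring8_reweight_emeryInteraction (w : Finset (Site 2) → ℝ) (θ : Fin 14 → ℝ) :
    relabel (Orb.mapEquiv ring8SiteEquiv)
        ((⟨fun X => (w X : ℂ) • (emeryInteraction θ).Φ X⟩ : FermionInteraction 2).localHamiltonian emeryRing8Window) =
      hubbardOpenBoxGP 1 8 (fun i j => emeryTau w θ emeryRing8Window (ring8SiteEquiv.symm i) (ring8SiteEquiv.symm j))
        (fun i => emeryUps w θ emeryRing8Window (ring8SiteEquiv.symm i)) (fun i => emeryNu w θ emeryRing8Window (ring8SiteEquiv.symm i)) := by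
  rw [localHamiltonian_reweight_emeryInteraction_eq_generalPair, relabel_generalPairHamiltonian, hubbardOpenBoxGP_eq_generalPairHamiltonian]

/-- **SECTOR FLOORS ⇒ WINDOW CERTIFICATE (any weight)** on the ring-8. [cite: KullEtAl2024, §5.3] -/
theorem posSemidef_ring8_reweight_sub_of_gpSectorFloors (w : Finset (Site 2) → ℝ) (θ : Fin 14 → ℝ) {q : ℝ}
    (hq : ∀ k ≤ 16, q ≤ groundEnergy (hubbardOpenBoxGP 1 8 (fun i j => emeryTau w θ emeryRing8Window (ring8SiteEquiv.symm i) (ring8SiteEquiv.symm j))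
        (fun i => emeryUps w θ emeryRing8Window (ring8SiteEquiv.symm i)) (fun i => emeryNu w θ emeryRing8Window (ring8SiteEquiv.symm i))) k) :
    (((⟨fun X => (w X : ℂ) • (emeryInteraction θ).Φ X⟩ : FermionInteraction 2).localHamiltonian emeryRing8Window) -
      (q : ℂ) • (1 : FermionOp emeryRing8Window)).PosSemidef := by
  have h := posSemidef_hubbardOpenBoxGP_sub_smul_one_of_sectors _ (fun i j => emeryTau_symm w θ _ _ _) _ _ fun k hk => hq k (by simpa using hk)
  have h' := posSemidef_relabel (Orb.mapEquiv ring8SiteEquiv).symm h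
  rw [map_sub, map_smul, relabel_one_generic', ← relabel_ring8_reweight_emeryInteraction, relabel_symm_relabel] at h'
  exact h'

/-! ### §3. The uniform-weight tables on the ring-8 -/

section Tables

/-- **The bond class joining two ranks of the ring-8** (`8` = none). [cite: PavariniEtAl2001, eq. (1)] -/
def ring8AtomOf : Fin 8 → Fin 8 → Fin 14 :=
  ![![8, 2, 8, 0, 8, 8, 8, 8], ![2, 8, 3, 5, 7, 8, 8, 8], ![8, 3, 8, 8, 0, 8, 8, 8], ![0, 5, 8, 8, 8, 1, 4, 8],
    ![8, 7, 0, 8, 8, 8, 6, 1], ![8, 8, 8, 1, 8, 8, 2, 8], ![8, 8, 8, 4, 6, 2, 8, 3], ![8, 8, 8, 8, 1, 8, 3, 8]]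

/-- The repulsion atom living on each rank (`11` Cu, `12` O_x, `13` O_y). [cite: PavariniEtAl2001, eq. (1)] -/
def ring8UAtomOf : Fin 8 → Fin 14 := ![11, 13, 11, 12, 12, 11, 13, 11]

/-- The site-energy atom living on each rank (`8` Cu, `9` O_x, `10` O_y). [cite: PavariniEtAl2001, eq. (1)] -/
def ring8EpsAtomOf : Fin 8 → Fin 14 := ![8, 10, 8, 9, 9, 8, 10, 8]

/-- **THE BOND TABLE OF THE RING-8** (kernel-decided). [cite: PavariniEtAl2001, eq. (1)] -/
theorem hopIndNat_ring8 (a : Fin 14) (k l : Fin 8) :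
    (if a.1 < 8 then hopIndNat liebPeriods (emeryAtomCoset a) (emeryAtomVec a) (ring8Site k) (ring8Site l) else 0) =
      if a = ring8AtomOf k l ∧ (ring8AtomOf k l).1 < 8 then 1 else 0 := by
  revert a k l
  decide

/-- **THE REPULSION TABLE OF THE RING-8** (kernel-decided). [cite: PavariniEtAl2001, eq. (1)] -/
theorem emeryAtomUNat_mul_coset_ring8 (a : Fin 14) (k : Fin 8) :
    emeryAtomUNat a * (if InCoset liebPeriods (emeryAtomCoset a) (ring8Site k) then 1 else 0) = if a = ring8UAtomOf k then 1 else 0 := by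
  revert a k
  decide

/-- **THE SITE-ENERGY TABLE OF THE RING-8** (kernel-decided). [cite: PavariniEtAl2001, eq. (1)] -/
theorem emeryAtomEpsNat_mul_coset_ring8 (a : Fin 14) (k : Fin 8) :
    emeryAtomEpsNat a * (if InCoset liebPeriods (emeryAtomCoset a) (ring8Site k) then 1 else 0) = if a = ring8EpsAtomOf k then 1 else 0 := by
  revert a k
  decide

/-- **PLACEMENT COUNTS OF THE BONDS OF THE RING-8** (kernel-decided): every Cu–O bond class has TWO even translates inside the window, every O–O class ONE.
[cite: ValentiStolzeHirschfeld1991, §II] -/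
theorem superlatPlacementCount_ring8_bond (k l : Fin 8) (h : (ring8AtomOf k l).1 < 8) :
    superlatPlacementCount liebPeriods emeryRing8Window ({ring8Site k, ring8Site l} : Finset (Site 2)) = if (ring8AtomOf k l).1 < 4 then 2 else 1 := by
  revert k l
  decide

/-- The singleton counts (Cu `4`, O `2`). [cite: ValentiStolzeHirschfeld1991, §II] -/
theorem superlatPlacementCount_ring8_single (k : Fin 8) :
    superlatPlacementCount liebPeriods emeryRing8Window ({ring8Site k} : Finset (Site 2)) = (![4, 2, 4, 2, 2, 4, 2, 4] : Fin 8 → ℕ) k := by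
  revert k
  decide

variable (θ : Fin 14 → ℝ) (M : ℝ)

/-- **The pair table `τ` of the uniformly weighted ring-8** (Cu–O entries `M·θ_a/2`, O–O entries `M·θ_a`). [cite: ValentiStolzeHirschfeld1991, §II] -/
def ring8Tau (i j : Fin 1 ×ₗ Fin 8) : ℝ :=
  M * (![![0, θ 2 / 2, 0, θ 0 / 2, 0, 0, 0, 0],
         ![θ 2 / 2, 0, θ 3 / 2, θ 5, θ 7, 0, 0, 0],
         ![0, θ 3 / 2, 0, 0, θ 0 / 2, 0, 0, 0],
         ![θ 0 / 2, θ 5, 0, 0, 0, θ 1 / 2, θ 4, 0],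
         ![0, θ 7, θ 0 / 2, 0, 0, 0, θ 6, θ 1 / 2],
         ![0, 0, 0, θ 1 / 2, 0, 0, θ 2 / 2, 0],
         ![0, 0, 0, θ 4, θ 6, θ 2 / 2, 0, θ 3 / 2],
         ![0, 0, 0, 0, θ 1 / 2, 0, θ 3 / 2, 0]] : Fin 8 → Fin 8 → ℝ) (ofLex i).2 (ofLex j).2

/-- **The repulsion table `υ` of the uniformly weighted ring-8.** [cite: ValentiStolzeHirschfeld1991, §II] -/
def ring8Ups (i : Fin 1 ×ₗ Fin 8) : ℝ :=
  M * (![θ 11 / 4, θ 13 / 2, θ 11 / 4, θ 12 / 2, θ 12 / 2, θ 11 / 4, θ 13 / 2, θ 11 / 4] : Fin 8 → ℝ) (ofLex i).2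

/-- **The site-energy table `ν` of the uniformly weighted ring-8.** [cite: ValentiStolzeHirschfeld1991, §II] -/
def ring8Nu (i : Fin 1 ×ₗ Fin 8) : ℝ :=
  M * (![θ 8 / 4, θ 10 / 2, θ 8 / 4, θ 9 / 2, θ 9 / 2, θ 8 / 4, θ 10 / 2, θ 8 / 4] : Fin 8 → ℝ) (ofLex i).2

/-- Every element of `Fin 1 ×ₗ Fin 8` is `(0, k)`. [folklore] -/
private theorem lex_eq_toLex₈ (i : Fin 1 ×ₗ Fin 8) : i = toLex ((0 : Fin 1), (ofLex i).2) := by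
  rw [show (0 : Fin 1) = (ofLex i).1 from Subsingleton.elim _ _, Prod.mk.eta, toLex_ofLex]

/-- The repulsion coefficient at a concrete site, as a cast of naturals. [cite: ValentiStolzeHirschfeld1991, §II] -/
private theorem emeryAtomUCoef_pt' (w : Finset (Site 2) → ℝ) {Λ : Finset (Site 2)} (a : Fin 14) (x : Site 2) (hx : x ∈ Λ) :
    emeryAtomUCoef w Λ a (PolySite.pt x hx) =
      w {x} * ((emeryAtomUNat a * (if InCoset liebPeriods (emeryAtomCoset a) x then 1 else 0) : ℕ) : ℝ) := by
  unfold emeryAtomUCoef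
  rw [PolySite.ofLex_coe_pt, emeryAtomU_eq_cast]
  push_cast
  ring

/-- The site-energy coefficient at a concrete site, as a cast of naturals. [cite: ValentiStolzeHirschfeld1991, §II] -/
private theorem emeryAtomECoef_pt' (w : Finset (Site 2) → ℝ) {Λ : Finset (Site 2)} (a : Fin 14) (x : Site 2) (hx : x ∈ Λ) :
    emeryAtomECoef w Λ a (PolySite.pt x hx) =
      w {x} * ((emeryAtomEpsNat a * (if InCoset liebPeriods (emeryAtomCoset a) x then 1 else 0) : ℕ) : ℝ) := by
  unfold emeryAtomECoef
  rw [PolySite.ofLex_coe_pt, emeryAtomEps_eq_cast]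
  push_cast
  ring

/-- The pair coefficient at concrete sites, as a cast of naturals. [cite: ValentiStolzeHirschfeld1991, §II] -/
private theorem emeryAtomPairCoef_pt' (w : Finset (Site 2) → ℝ) {Λ : Finset (Site 2)} (a : Fin 14) (x y : Site 2) (hx : x ∈ Λ) (hy : y ∈ Λ) :
    emeryAtomPairCoef w Λ a (PolySite.pt x hx) (PolySite.pt y hy) =
      w {x, y} * ((if a.1 < 8 then hopIndNat liebPeriods (emeryAtomCoset a) (emeryAtomVec a) x y else 0 : ℕ) : ℝ) := by
  unfold emeryAtomPairCoef
  rw [PolySite.ofLex_coe_pt, PolySite.ofLex_coe_pt, hopInd_eq_cast]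
  push_cast
  rfl

/-- **The pair coefficients of the uniformly weighted ring-8 are the table `ring8Tau`.** [cite: ValentiStolzeHirschfeld1991, §II] -/
theorem emeryTau_uniform_ring8 (i j : Fin 1 ×ₗ Fin 8) :
    emeryTau (uniformPeriodicWeight liebPeriods emeryRing8Window M) θ emeryRing8Window (ring8SiteEquiv.symm i) (ring8SiteEquiv.symm j) = ring8Tau θ M i j := by
  rw [lex_eq_toLex₈ i, lex_eq_toLex₈ j]
  generalize (ofLex i).2 = k
  generalize (ofLex j).2 = l
  show emeryTau (uniformPeriodicWeight liebPeriods emeryRing8Window M) θ emeryRing8Window (PolySite.pt (ring8Site k) (ring8Site_mem k))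
    (PolySite.pt (ring8Site l) (ring8Site_mem l)) = _
  rw [emeryTau, Finset.sum_eq_single (ring8AtomOf k l)]
  · rw [emeryAtomPairCoef_pt', hopIndNat_ring8, uniformPeriodicWeight]
    by_cases hb : (ring8AtomOf k l).1 < 8
    · rw [if_pos ⟨rfl, hb⟩, superlatPlacementCount_ring8_bond k l hb]
      fin_cases k <;> fin_cases l <;> simp [ring8AtomOf, ring8Tau] at hb ⊢ <;> ring
    · rw [if_neg (fun h => hb h.2)]
      fin_cases k <;> fin_cases l <;> simp [ring8AtomOf, ring8Tau] at hb ⊢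
  · intro a _ ha
    rw [emeryAtomPairCoef_pt', hopIndNat_ring8, if_neg (fun h => ha h.1)]
    simp
  · exact fun h => absurd (Finset.mem_univ _) h

/-- **The repulsion coefficients of the uniformly weighted ring-8 are the table `ring8Ups`.** [cite: ValentiStolzeHirschfeld1991, §II] -/
theorem emeryUps_uniform_ring8 (i : Fin 1 ×ₗ Fin 8) :
    emeryUps (uniformPeriodicWeight liebPeriods emeryRing8Window M) θ emeryRing8Window (ring8SiteEquiv.symm i) = ring8Ups θ M i := by
  rw [lex_eq_toLex₈ i]
  generalize (ofLex i).2 = k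
  show emeryUps (uniformPeriodicWeight liebPeriods emeryRing8Window M) θ emeryRing8Window (PolySite.pt (ring8Site k) (ring8Site_mem k)) = _
  rw [emeryUps, Finset.sum_eq_single (ring8UAtomOf k)]
  · rw [emeryAtomUCoef_pt', emeryAtomUNat_mul_coset_ring8, if_pos rfl, uniformPeriodicWeight, superlatPlacementCount_ring8_single]
    fin_cases k <;> simp [ring8UAtomOf, ring8Ups] <;> ring
  · intro a _ ha
    rw [emeryAtomUCoef_pt', emeryAtomUNat_mul_coset_ring8, if_neg ha]
    simp
  · exact fun h => absurd (Finset.mem_univ _) h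

/-- **The site-energy coefficients of the uniformly weighted ring-8 are the table `ring8Nu`.** [cite: ValentiStolzeHirschfeld1991, §II] -/
theorem emeryNu_uniform_ring8 (i : Fin 1 ×ₗ Fin 8) :
    emeryNu (uniformPeriodicWeight liebPeriods emeryRing8Window M) θ emeryRing8Window (ring8SiteEquiv.symm i) = ring8Nu θ M i := by
  rw [lex_eq_toLex₈ i]
  generalize (ofLex i).2 = k
  show emeryNu (uniformPeriodicWeight liebPeriods emeryRing8Window M) θ emeryRing8Window (PolySite.pt (ring8Site k) (ring8Site_mem k)) = _
  rw [emeryNu, Finset.sum_eq_single (ring8EpsAtomOf k)]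
  · rw [emeryAtomECoef_pt', emeryAtomEpsNat_mul_coset_ring8, if_pos rfl, uniformPeriodicWeight, superlatPlacementCount_ring8_single]
    fin_cases k <;> simp [ring8EpsAtomOf, ring8Nu] <;> ring
  · intro a _ ha
    rw [emeryAtomECoef_pt', emeryAtomEpsNat_mul_coset_ring8, if_neg ha]
    simp
  · exact fun h => absurd (Finset.mem_univ _) h

end Tables

/-! ### §4. The window certificate and the turnkey floor from kernel sector floors -/

section Final

variable (θ : Fin 14 → ℝ) (M : ℝ)

/-- **THE RING-8 DICTIONARY (uniform weight of mass `M`).** [cite: ValentiStolzeHirschfeld1991, §II] [cite: PavariniEtAl2001, eq. (1)] -/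
theorem relabel_ring8_uniform_emeryInteraction :
    relabel (Orb.mapEquiv ring8SiteEquiv)
        ((⟨fun X => (uniformPeriodicWeight liebPeriods emeryRing8Window M X : ℂ) • (emeryInteraction θ).Φ X⟩ : FermionInteraction 2).localHamiltonian
          emeryRing8Window) =
      hubbardOpenBoxGP 1 8 (ring8Tau θ M) (ring8Ups θ M) (ring8Nu θ M) := by
  rw [relabel_ring8_reweight_emeryInteraction]
  have hτ : (fun i j => emeryTau (uniformPeriodicWeight liebPeriods emeryRing8Window M) θ emeryRing8Window (ring8SiteEquiv.symm i) (ring8SiteEquiv.symm j)) =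
      ring8Tau θ M := funext fun i => funext fun j => emeryTau_uniform_ring8 θ M i j
  have hυ : (fun i => emeryUps (uniformPeriodicWeight liebPeriods emeryRing8Window M) θ emeryRing8Window (ring8SiteEquiv.symm i)) = ring8Ups θ M :=
    funext fun i => emeryUps_uniform_ring8 θ M i
  have hν : (fun i => emeryNu (uniformPeriodicWeight liebPeriods emeryRing8Window M) θ emeryRing8Window (ring8SiteEquiv.symm i)) = ring8Nu θ M :=
    funext fun i => emeryNu_uniform_ring8 θ M i
  rw [hτ, hυ, hν]

/-- `ring8Tau` is symmetric. [cite: ValentiStolzeHirschfeld1991, §II] -/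
theorem ring8Tau_symm (i j : Fin 1 ×ₗ Fin 8) : ring8Tau θ M i j = ring8Tau θ M j i := by
  rw [← emeryTau_uniform_ring8, ← emeryTau_uniform_ring8, emeryTau_symm]

/-- **KERNEL SECTOR FLOORS ⇒ THE RING-8 WINDOW CERTIFICATE**: `q ≤ E₀(hubbardOpenBoxGP 1 8 (ring8Tau θ M) (ring8Ups θ M) (ring8Nu θ M), k)` for every `k ≤ 16`
gives `H^{w_M}_{W₈}[emeryInteraction θ] − q•1 ⪰ 0`. [cite: KullEtAl2024, §5.3] -/
theorem posSemidef_ring8_uniform_sub_of_gpSectorFloors {q : ℝ}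
    (hq : ∀ k ≤ 16, q ≤ groundEnergy (hubbardOpenBoxGP 1 8 (ring8Tau θ M) (ring8Ups θ M) (ring8Nu θ M)) k) :
    (((⟨fun X => (uniformPeriodicWeight liebPeriods emeryRing8Window M X : ℂ) • (emeryInteraction θ).Φ X⟩ : FermionInteraction 2).localHamiltonian
        emeryRing8Window) - (q : ℂ) • (1 : FermionOp emeryRing8Window)).PosSemidef := by
  have h := posSemidef_hubbardOpenBoxGP_sub_smul_one_of_sectors (ring8Tau θ M) (ring8Tau_symm θ M) (ring8Ups θ M) (ring8Nu θ M)
    (q := q) fun k hk => hq k (by simpa using hk)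
  have h' := posSemidef_relabel (Orb.mapEquiv ring8SiteEquiv).symm h
  rw [map_sub, map_smul, relabel_one_generic', ← relabel_ring8_uniform_emeryInteraction, relabel_symm_relabel] at h'
  exact h'

/-- **THE TURNKEY RING-8 FLOOR FROM KERNEL SECTOR FLOORS**: for `M > 0` and `0 ≤ ρ ≤ 3/2`, sector floors `q ≤ E₀(h^G, k)` (`k ≤ 16`) of the general-pair
cluster with the ring-8 tables give `q/(4M) ≤ emeryEnergyDensity θ ρ` (apply at `θ + μ•levelDir` and subtract `μρ` on the consumer side for the tilt).
[cite: ValentiStolzeHirschfeld1991, §II] [cite: KullEtAl2024, §5.3] -/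
theorem le_emeryEnergyDensity_of_ring8_gpSectorFloors {ρ : ℝ} (hρ0 : 0 ≤ ρ) (hρ1 : ρ ≤ 3 / 2) (hM : 0 < M) {q : ℝ}
    (hq : ∀ k ≤ 16, q ≤ groundEnergy (hubbardOpenBoxGP 1 8 (ring8Tau θ M) (ring8Ups θ M) (ring8Nu θ M)) k) :
    q / (4 * M) ≤ emeryEnergyDensity θ ρ := by
  have h := posSemidef_ring8_uniform_sub_of_gpSectorFloors θ M hq
  refine InfVolFermionState.le_emeryEnergyDensity_of_windowCertificate θ (InfVolFermionState.emeryStates_nonempty hρ0 hρ1)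
    emeryRingWindow_subset_ring8 hM (G := 0) (fun ω' _ => by rw [map_zero, Complex.zero_re]) ?_
  rw [add_zero]
  exact h

/-- **THE TURNKEY PLUS FLOOR FROM KERNEL SECTOR FLOORS** (the same for the 5-site plus of `EmeryThreeBandCuO4ClusterDictionary`).
[cite: ValentiStolzeHirschfeld1991, §II] [cite: KullEtAl2024, §5.3] -/
theorem le_emeryEnergyDensity_of_cuO4_gpSectorFloors {ρ : ℝ} (hρ0 : 0 ≤ ρ) (hρ1 : ρ ≤ 3 / 2) (hM : 0 < M) {q : ℝ}
    (hq : ∀ k ≤ 10, q ≤ groundEnergy (hubbardOpenBoxGP 1 5 (plusTau θ M) (plusUps θ M) (plusNu θ M)) k) :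
    q / (4 * M) ≤ emeryEnergyDensity θ ρ := by
  have h := posSemidef_cuO4_uniform_sub_of_gpSectorFloors θ M hq
  refine InfVolFermionState.le_emeryEnergyDensity_of_cuO4Certificate' θ hρ0 hρ1 hM (G := 0) (fun ω' _ => by rw [map_zero, Complex.zero_re]) ?_
  rw [add_zero]
  exact h

end Final

end Literature.MathematicalPhysics.QuantumLattice

end
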